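import Literature.AlgebraicGeometry.Resolution.GeneralizedStability
import Mathlib.Algebra.Group.Subgroup.Finsupp
import HarnessLib

/-!
# The generalized stability theorem for `k(x, y)`: reduction to trdeg one (Kuhlmann 2010, Lemma 5.1)

Topic: `Literature/AlgebraicGeometry/Resolution` (valued function fields). Second layer of the
decomposition of the named fact `Kuhlmann2010Stability` (`ValuationDefect.lean`) = F.-V. Kuhlmann,
*Elimination of ramification I: The generalized stability theorem*, Trans. AMS 362 (2010)
5697–5727 = arXiv:1003.5678, **Thm. 1.1**, along the printed proof. `GeneralizedStability.lean`
reduced it (Cor. 2.6, Cor. 2.16) to the fundamental inequality and to the rational case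
`Kuhlmann2010StabilityRational` = Thm. 1.1 for `F = k(x₁, …, x_r, y₁, …, y_s)` generated over the
TRIVIALLY valued `k` by a standard valuation transcendence basis. The source proves Thm. 1.1 in
§5 by "a stepwise reduction"; its first step is

> **Lemma 5.1.** To prove Theorem 1.1, it suffices to prove
> (R1) Every valued function field of transcendence degree 1 without transcendence defect over
> a defectless ground field is a defectless field.
> *Proof.* By induction on the transcendence degree of the function field. The case of
> transcendence degree 1 is covered by (R1). Assume that `(F|K,v)` is a valued function field of
> transcendence degree `> 1` without transcendence defect. Choose any subfunction field `F₀|K`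
> in `F|K` such that `0 < trdeg F₀|K < trdeg F|K`. By the additivity of transcendence degree and
> rational rank, both `(F₀|K,v)` and `(F|F₀,v)` are valued function fields without transcendence
> defect. Hence if `(K,v)` is a defectless field, then by induction hypothesis, `(F₀,v)` and
> consequently also `(F,v)` is a defectless field.

This file carries out Lemma 5.1 for the rational case: with `F₀ = k(x₁, …, x_{r-1}, y)` the
last step `F = F₀(x_r)` is a valued RATIONAL function field of transcendence degree `1` whose
generator `x_r` is value-transcendental over `F₀` (its value is rationally independent over
`vF₀ = ⊕_{i<r} ℤ vxᵢ`, Lemma 2.5), and the base `k(y)` is trivially valued (Lemma 2.5: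
`vK(xᵢ, yⱼ) = vK ⊕ ⊕ᵢ ℤ vxᵢ` with `I = ∅`, `vk = 0`), hence defectless (§1, p. 3: "every
trivially valued field is a defectless field" = `isDefectlessField_top`). So the only case of
(R1) that the rational case needs is Thm. 1.1 for `F = K(t)` with `t` VALUE-TRANSCENDENTAL over
a defectless `(K, v)` — vendored here as the named fact
`Kuhlmann2010StabilityValueTranscendental`; its printed proof is Lemmas 5.2–5.4 ((R1) ⇐ (R2) ⇐
(R3) ⇐ (R4): algebraically closed ground fields via Cor. 2.25, finite rank via henselizations
and Prop. 2.24, rank 1 via composite valuations, Lemmas 2.8 and 2.17) and the analysis of (R4)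
(§§3–4: Prop. 3.1, Cor. 4.2, Lemma 5.5, Prop. 2.18), not available in Mathlib (no
henselization of valued fields).

## Content

* `Kuhlmann2010StabilityValueTranscendental` — NAMED FACT: Thm. 1.1 for a valued rational
  function field `F = K(t)` whose generator `t` is value-transcendental over the defectless
  `(K, v)` (§2.5: "a value-transcendental element `x ∈ F`, i.e., its value `vx` is rationally
  independent over `vK`"): then `(F, v)` is a defectless field.
* `valuationSubring_eq_top_of_adjoin_residue` — `k(y)` is trivially valued: if `K = k(y)` with
  `k ⊆ K°` and the residues of the `yⱼ ∈ K°` algebraically independent over `k`, then `K° = K`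
  (Lemma 2.5 with no `xᵢ`). PROVED.
* `Kuhlmann2010StabilityRational.of_valueTranscendental :
  Kuhlmann2010StabilityValueTranscendental → Kuhlmann2010StabilityRational` — Lemma 5.1 for the
  rational case, PROVED by induction on `r`: `k(x_{<r}, y)° = K° ∩ k(x_{<r}, y)` is defectless by
  induction (its generators keep `ℤ`-independent values and algebraically independent residues,
  as in `Kuhlmann2010Stability.of_parts`), `x_r` is value-transcendental over it
  (`mk0_valuation_mem_closure_of_mem_adjoin`: `v k(x_{<r}, y)^× = ⟨vx₀, …, vx_{r-1}⟩`, and the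
  `vxᵢ` are `ℤ`-independent), and `K = k(x_{<r}, y)(x_r)`.

Consequently `Kuhlmann2010Stability` follows from `FundamentalInequality` and
`Kuhlmann2010StabilityValueTranscendental` (`Kuhlmann2010Stability.of_parts`).

## Sources

* F.-V. Kuhlmann, *Elimination of ramification I: The generalized stability theorem*, Trans.
  Amer. Math. Soc. 362 (2010) 5697–5727 = arXiv:1003.5678: §1 (Thm. 1.1; p. 3 "every trivially
  valued field is a defectless field"), §2.1 Lemma 2.5 (value group and residue field of
  `K(xᵢ, yⱼ)`), §2.5 (value-transcendental elements), §5 Lemma 5.1 and (R1), Lemmas 5.2–5.4.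

## Rendering notes

* As in `ValuationDefect.lean` / `GeneralizedStability.lean`: an extension of valued fields is
  `[Algebra K F]` plus `O : ValuationSubring F`, the valuation ring of `K` being
  `O.comap (algebraMap K F)`; "`F = K(t)`" is `IntermediateField.adjoin K {t} = ⊤`; "`t` is
  value-transcendental over `K`" (`vt` rationally independent over `vK`, i.e. `n·vt ∉ vK` for
  `n ≥ 1`) is `∀ n ≥ 1, ∀ c : K, v(t)^n ≠ v(c)` (for `c = 0` this forces `t ≠ 0`).
-/

noncomputable section

open IsLocalRing

namespace Literature.AlgebraicGeometry.Resolution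

universe u

/-! ### Thm. 1.1 in transcendence degree one, value-transcendental generator (named fact) -/

/-- NAMED FACT — **Kuhlmann 2010, Thm. 1.1 for a valued rational function field with a
value-transcendental generator** (the case of (R1), §5, Lemma 5.1 — "(R1) Every valued function
field of transcendence degree 1 without transcendence defect over a defectless ground field is a
defectless field" — to which Lemma 5.1 reduces Thm. 1.1 "by induction on the transcendence
degree", here for `F = K(t)` rational; Thm. 1.1: "Let `(F|K, v)` be a valued function field
without transcendence defect. If `(K, v)` is a defectless field, then `(F, v)` is a defectless
field"; §2.5: "a value-transcendental element `x ∈ F`, i.e., its value `vx` is rationally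
independent over `vK` … `x` is transcendental over `K` by Lemma 2.5"). Statement: let `K → F`
be an extension of valued fields (`K° = F° ∩ K`) with `F = K(t)` for an element `t` whose value
is rationally independent over `vK` (`n · vt ∉ vK` for all `n ≥ 1`); then `t` is transcendental
over `K` (Lemma 2.5), `vF = vK ⊕ ℤ vt` and `Fv = Kv` (Lemma 2.5), so `(F|K, v)` is a valued
(rational) function field of transcendence degree `1 = rr vF/vK` without transcendence defect,
and Thm. 1.1 says: if `(K, K°)` is a defectless field then so is `(F, F°)`. Its printed proof is
§5, Lemmas 5.2–5.4 and the proof of (R4) (Cor. 2.25, Thm. 2.14, Prop. 2.24, Lemmas 2.8, 2.17,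
2.27, Prop. 2.18, Prop. 3.1, Cor. 4.2, Lemma 5.5), resting on henselizations of valued fields,
which Mathlib does not have. Users take `(h : Kuhlmann2010StabilityValueTranscendental)`.
[cite: Kuhlmann2010, Thm. 1.1 and Section 5, Lemma 5.1 (R1)] -/
def Kuhlmann2010StabilityValueTranscendental : Prop :=
  ∀ (K F : Type u) [Field K] [Field F] [Algebra K F] (O : ValuationSubring F) (t : F),
    (∀ n : ℕ, 0 < n → ∀ c : K, O.valuation t ^ n ≠ O.valuation (algebraMap K F c)) →
    IntermediateField.adjoin K ({t} : Set F) = ⊤ →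
    IsDefectlessField K (O.comap (algebraMap K F)) → IsDefectlessField F O

/-! ### `k(y)` is trivially valued (Lemma 2.5 with no value-transcendental generators) -/

section TriviallyValued

variable {k K : Type u} [Field k] [Field K] [Algebra k K] (O : ValuationSubring K)
  [Algebra k O] [IsScalarTower k O K]

/-- **`k(y)` is trivially valued** (Kuhlmann 2010, Lemma 2.5 with `I = ∅`:
`vK(yⱼ | j ∈ J) = vK`, here over the trivially valued `k ⊆ K°`): if `K = k(y₁, …, y_s)` with
`yⱼ ∈ K°` of residues algebraically independent over `k`, then `K° = K`. PROVED (the value of a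
non-zero element of `k(y)` lies in the subgroup generated by the values of NO elements,
`mk0_valuation_mem_closure_of_mem_adjoin`). [cite: Kuhlmann2010, Lemma 2.5] -/
theorem valuationSubring_eq_top_of_adjoin_residue {s : ℕ} (y : Fin s → O)
    (hy : AlgebraicIndependent k fun j => residue O (y j))
    (hgen : IntermediateField.adjoin k (Set.range fun j => (y j : K)) = ⊤) : O = ⊤ := by
  ext t
  refine ⟨fun _ => ValuationSubring.mem_top t, fun _ => ?_⟩
  by_cases ht0 : t = 0
  · rw [ht0]
    exact zero_mem O
  -- no value-transcendental generators
  let x : Fin 0 → K := Fin.elim0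
  have hx0 : ∀ j, x j ≠ 0 := fun j => j.elim0
  have hx : LinearIndependent ℤ fun j =>
      Additive.ofMul (Units.mk0 (O.valuation (x j)) (valuation_ne_zero_of_ne_zero O (hx0 j))) :=
    linearIndependent_empty_type
  have ht : t ∈ IntermediateField.adjoin k ((Set.range fun j => (y j : K)) ∪ Set.range x) := by
    rw [Set.range_eq_empty x, Set.union_empty, hgen]
    exact IntermediateField.mem_top
  have hmem := mk0_valuation_mem_closure_of_mem_adjoin O y x hy hx0 hx ht ht0
  rw [Set.range_eq_empty, Subgroup.closure_empty, Subgroup.mem_bot] at hmem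
  have hv1 : O.valuation t = 1 := by
    have h := congrArg Units.val hmem
    rwa [Units.val_mk0, Units.val_one] at h
  exact (O.valuation_le_one_iff t).mp hv1.le

end TriviallyValued

/-! ### Lemma 5.1 for the rational case: induction on the number of value-transcendental generators -/

section Reduction

/-- **Kuhlmann 2010, Thm. 1.1 for `k(x, y)` over a trivially valued `k`, from the
value-transcendental case in transcendence degree one** (Lemma 5.1: "To prove Theorem 1.1, it
suffices to prove (R1) … By induction on the transcendence degree of the function field …
Choose any subfunction field `F₀|K` in `F|K` … both `(F₀|K,v)` and `(F|F₀,v)` are valued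
function fields without transcendence defect. Hence if `(K,v)` is a defectless field, then by
induction hypothesis, `(F₀,v)` and consequently also `(F,v)` is a defectless field"). PROVED,
by induction on `r` with `F₀ = k(x₁, …, x_{r-1}, y)`: for `r = 0`, `k(y)` is trivially valued
(`valuationSubring_eq_top_of_adjoin_residue`) hence defectless (`isDefectlessField_top`, §1
p. 3); for `r ≥ 1`, `(F₀, K° ∩ F₀)` is defectless by induction (its generators keep
`ℤ`-independent values, `unitsValueGroupHom_injective`, and algebraically independent residues,
`residueFieldAlgHom`), `x_r` is value-transcendental over `F₀` (the values of `F₀^×` are the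
monomials in `vx₁, …, vx_{r-1}`, `mk0_valuation_mem_closure_of_mem_adjoin` = Lemma 2.5, and
`vx₁, …, vx_r` are `ℤ`-independent) and `F = F₀(x_r)`, so `(F, K°)` is defectless by
`Kuhlmann2010StabilityValueTranscendental`. [cite: Kuhlmann2010, Section 5, Lemma 5.1] -/
theorem Kuhlmann2010StabilityRational.of_valueTranscendental
    (hVT : Kuhlmann2010StabilityValueTranscendental.{u}) :
    Kuhlmann2010StabilityRational.{u} := by
  suffices H : ∀ (r : ℕ) (k K : Type u) [Field k] [Field K] [Algebra k K] (O : ValuationSubring K)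
      [Algebra k O] [IsScalarTower k O K] (s : ℕ) (x : Fin r → K) (y : Fin s → O)
      (hx0 : ∀ i, x i ≠ 0),
      LinearIndependent ℤ (fun i =>
        Additive.ofMul (Units.mk0 (O.valuation (x i)) (valuation_ne_zero_of_ne_zero O (hx0 i)))) →
      AlgebraicIndependent k (fun j => residue O (y j)) →
      IntermediateField.adjoin k (Set.range x ∪ Set.range fun j => (y j : K)) = ⊤ →
      IsDefectlessField K O by
    intro k K _ _ _ O _ _ r s x y hx0 hx hy hgen
    exact H r k K O s x y hx0 hx hy hgen
  intro r
  induction r with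
  | zero =>
    -- `K = k(y)` is trivially valued, hence defectless
    intro k K _ _ _ O _ _ s x y hx0 hx hy hgen
    have hgen' : IntermediateField.adjoin k (Set.range fun j => (y j : K)) = ⊤ := by
      rw [← hgen, Set.range_eq_empty x, Set.empty_union]
    rw [valuationSubring_eq_top_of_adjoin_residue O y hy hgen']
    exact isDefectlessField_top K
  | succ r ih =>
    intro k K _ _ _ O _ _ s x y hx0 hx hy hgen
    classical
    -- the subfunction field `F₀ = k(x₁, …, x_{r-1}, y)` and its valuation ring `K° ∩ F₀`
    let x' : Fin r → K := fun i => x (Fin.castSucc i)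
    let F₀ : IntermediateField k K :=
      IntermediateField.adjoin k (Set.range x' ∪ Set.range fun j => (y j : K))
    let O₀ : ValuationSubring F₀ := O.comap (algebraMap F₀ K)
    have hk : ∀ c : k, algebraMap k K c ∈ O := fun c => by
      rw [IsScalarTower.algebraMap_apply k O K]
      exact (algebraMap k O c).2
    have hk₀ : ∀ c : k, algebraMap k F₀ c ∈ O₀ := fun c => by
      change algebraMap F₀ K (algebraMap k F₀ c) ∈ O
      rw [← IsScalarTower.algebraMap_apply]
      exact hk c
    letI : Algebra k O₀ := algebraOfMem k O₀ hk₀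
    haveI : IsScalarTower k O₀ F₀ := isScalarTower_algebraOfMem k O₀ hk₀
    have hx'mem : ∀ i, x' i ∈ F₀ := fun i =>
      IntermediateField.subset_adjoin _ _ (Or.inl ⟨i, rfl⟩)
    have hymem : ∀ j, (y j : K) ∈ F₀ := fun j =>
      IntermediateField.subset_adjoin _ _ (Or.inr ⟨j, rfl⟩)
    let x₀ : Fin r → F₀ := fun i => ⟨x' i, hx'mem i⟩
    let y₀ : Fin s → O₀ := fun j => ⟨⟨(y j : K), hymem j⟩, (y j).2⟩
    have hx'0 : ∀ i, x' i ≠ 0 := fun i => hx0 _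
    have hx₀0 : ∀ i, x₀ i ≠ 0 := fun i h => hx'0 i (congrArg Subtype.val h)
    -- the values of `x₁, …, x_{r-1}` are `ℤ`-independent, in `|K^×|` and in `|F₀^×| ⊆ |K^×|`
    have hx'li : LinearIndependent ℤ fun i => Additive.ofMul
        (Units.mk0 (O.valuation (x' i)) (valuation_ne_zero_of_ne_zero O (hx'0 i))) :=
      hx.comp Fin.castSucc (Fin.castSucc_injective r)
    have hx₀ : LinearIndependent ℤ fun i => Additive.ofMul
        (Units.mk0 (O₀.valuation (x₀ i)) (valuation_ne_zero_of_ne_zero O₀ (hx₀0 i))) := by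
      refine LinearIndependent.of_comp
        (MonoidHom.toAdditive (unitsValueGroupHom F₀ O)).toIntLinearMap ?_
      have hcomp : (⇑(MonoidHom.toAdditive (unitsValueGroupHom F₀ O)).toIntLinearMap ∘ fun i =>
          Additive.ofMul (Units.mk0 (O₀.valuation (x₀ i))
            (valuation_ne_zero_of_ne_zero O₀ (hx₀0 i)))) = fun i =>
          Additive.ofMul (Units.mk0 (O.valuation (x' i))
            (valuation_ne_zero_of_ne_zero O (hx'0 i))) := by
        funext i
        have hu : unitsValueGroupHom F₀ O
            (Units.mk0 (O₀.valuation (x₀ i)) (valuation_ne_zero_of_ne_zero O₀ (hx₀0 i))) =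
            Units.mk0 (O.valuation (x' i)) (valuation_ne_zero_of_ne_zero O (hx'0 i)) :=
          Units.ext rfl
        change Additive.ofMul (unitsValueGroupHom F₀ O
          (Units.mk0 (O₀.valuation (x₀ i)) (valuation_ne_zero_of_ne_zero O₀ (hx₀0 i)))) =
          Additive.ofMul (Units.mk0 (O.valuation (x' i)) (valuation_ne_zero_of_ne_zero O (hx'0 i)))
        rw [hu]
      rw [hcomp]
      exact hx'li
    -- the residues of the `yⱼ` stay algebraically independent over `k`
    have hy₀ : AlgebraicIndependent k fun j => residue O₀ (y₀ j) := by
      refine AlgebraicIndependent.of_comp (residueFieldAlgHom F₀ O) ?_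
      convert hy using 1
      funext j
      change residueFieldHom F₀ O (residue O₀ (y₀ j)) = residue O (y j)
      rw [residueFieldHom_residue]
      rfl
    -- `F₀` is generated over `k` by `x', y`
    have hgen₀ :
        IntermediateField.adjoin k (Set.range x₀ ∪ Set.range fun j => (y₀ j : F₀)) = ⊤ := by
      apply IntermediateField.lift_injective F₀
      rw [IntermediateField.lift_adjoin, IntermediateField.lift_top, Set.image_union,
        ← Set.range_comp, ← Set.range_comp]
      rfl
    -- induction hypothesis: `(F₀, K° ∩ F₀)` is a defectless field
    have hF₀ : IsDefectlessField F₀ O₀ := ih k F₀ O₀ s x₀ y₀ hx₀0 hx₀ hy₀ hgen₀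
    -- `x_r` is value-transcendental over `F₀` and `K = F₀(x_r)`
    refine hVT F₀ K O (x (Fin.last r)) ?_ ?_ hF₀
    · intro n hn c h
      change O.valuation (x (Fin.last r)) ^ n = O.valuation (c : K) at h
      have hc0 : (c : K) ≠ 0 := by
        intro hc
        rw [hc, map_zero] at h
        exact pow_ne_zero n (valuation_ne_zero_of_ne_zero O (hx0 (Fin.last r))) h
      have hcmem : (c : K) ∈
          IntermediateField.adjoin k ((Set.range fun j => (y j : K)) ∪ Set.range x') := by
        rw [Set.union_comm]
        exact c.2
      -- `v(c)` is a monomial in `vx₁, …, vx_{r-1}`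
      obtain ⟨a, ha⟩ := Subgroup.exists_of_mem_closure_range _ _
        (mk0_valuation_mem_closure_of_mem_adjoin O y x' hy hx'0 hx'li hcmem hc0)
      -- so `n · vx_r = ∑ aᵢ vxᵢ`, contradicting the `ℤ`-independence of `vx₁, …, vx_r`
      have hrel : Units.mk0 (O.valuation (x (Fin.last r)))
          (valuation_ne_zero_of_ne_zero O (hx0 (Fin.last r))) ^ n =
          ∏ i : Fin r, Units.mk0 (O.valuation (x' i))
            (valuation_ne_zero_of_ne_zero O (hx'0 i)) ^ a i := by
        rw [← ha]
        ext
        rw [Units.val_pow_eq_pow_val, Units.val_mk0, Units.val_mk0, h]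
      have hadd := congrArg Additive.ofMul hrel
      rw [ofMul_pow, ofMul_prod] at hadd
      simp_rw [ofMul_zpow] at hadd
      have hsum : ∑ i : Fin (r + 1), (Fin.snoc (fun j => -a j) (n : ℤ) : Fin (r + 1) → ℤ) i •
          Additive.ofMul (Units.mk0 (O.valuation (x i))
            (valuation_ne_zero_of_ne_zero O (hx0 i))) = 0 := by
        rw [Fin.sum_univ_castSucc]
        simp only [Fin.snoc_castSucc, Fin.snoc_last, neg_smul, Finset.sum_neg_distrib,
          natCast_zsmul]
        rw [hadd, neg_add_eq_zero]
      have hcoef := Fintype.linearIndependent_iff.mp hx _ hsum (Fin.last r)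
      simp only [Fin.snoc_last, Nat.cast_eq_zero] at hcoef
      exact hn.ne' hcoef
    · rw [← IntermediateField.restrictScalars_eq_top_iff (K := k),
        IntermediateField.adjoin_adjoin_left, eq_top_iff, ← hgen]
      refine IntermediateField.adjoin.mono k _ _ (Set.union_subset ?_ ?_)
      · rintro _ ⟨i, rfl⟩
        rcases Fin.eq_castSucc_or_eq_last i with ⟨j, rfl⟩ | rfl
        · exact Or.inl (Or.inl ⟨j, rfl⟩)
        · exact Or.inr rfl
      · rintro _ ⟨j, rfl⟩
        exact Or.inl (Or.inr ⟨j, rfl⟩)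

end Reduction

/-! ### Assembly: Thm. 1.1 over a trivially valued field from (1) and the value-transcendental case -/

/-- **Kuhlmann 2010, Thm. 1.1 over a trivially valued ground field** from the fundamental
inequality (1) and Thm. 1.1 in transcendence degree one with a value-transcendental generator:
`Kuhlmann2010Stability.of_parts` (Cor. 2.6, Cor. 2.16) composed with Lemma 5.1
(`Kuhlmann2010StabilityRational.of_valueTranscendental`). PROVED.
[cite: Kuhlmann2010, Thm. 1.1, Section 5, Lemma 5.1] -/
theorem Kuhlmann2010Stability.of_valueTranscendental (hFI : FundamentalInequality.{u})
    (hVT : Kuhlmann2010StabilityValueTranscendental.{u}) : Kuhlmann2010Stability.{u} :=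
  Kuhlmann2010Stability.of_parts hFI (Kuhlmann2010StabilityRational.of_valueTranscendental hVT)

end Literature.AlgebraicGeometry.Resolution
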